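import Mathlib
import Literature.Computability.AlgebraicComplexity.LRPencilOfMatrix
import Literature.Computability.AlgebraicComplexity.LandsbergRessayreNormalForm
import Literature.Computability.AlgebraicComplexity.StandardFamilies

/-!
# Crux `FreeSubtorus.OrbitDimensionBound` (stmt-ValiantsHypothesis-16133), line `Sketch` —
# stub `stub_layerDecomposition`: the layer cut of a graded normal form

Setting: an affine determinantal representation `B` (size `m`) of the generic permanent `per_n`,
`n ≥ 2`, in GRADED NORMAL FORM: integer potentials `a` (rows), `b` (columns) with a constant at
`(i, j)` only if `a i + b j = 0`, the variable `x_v` only if `a i + b j = 1`, and constant part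
`diag(1, …, 1)` with a single `0` at the diagonal position `i₀`.  Conclusion (the pencil form of
Gesmundo–Ghosal–Ikenmeyer–Lysikov 2022, Thm. 12, "cut a homogeneous ABP at layer `l`"): for every
`1 ≤ l ≤ n - 1` there are `g h : Fin m → ℂ[x]` with `per_n = Σ_j g_j h_j`, every `g_j` homogeneous
of degree `l`, and `g_j ≠ 0` only at the indices `j` of LEVEL `l` (`a j + l = a i₀`).

Proof.  Write `B = B₀ + L` with `L` the linear part (`LRPencil.eq_affine_of_totalDegree_le_one`),
`S = {j // j ≠ i₀}`, `N = -L|_{S × S}`, `u = (L i₀ t)_{t ∈ S}` (a row), `v = (L s i₀)_{s ∈ S}`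
(a column).  The diagonal `1`s force `b j = -a j` on `S`, so `N s t ≠ 0 ⇒ a s = a t + 1` and
`u t ≠ 0 ⇒ a t + 1 = a i₀`; along powers `(N^k) s t ≠ 0 ⇒ a s = a t + k`
(`wt_eq_of_pow_apply_ne_zero`), whence `N` is nilpotent (`pow_eq_zero_of_wt`) and `D = 1 - N`
(the `S × S` block of `B`) has the explicit inverse `E = Σ_{k<K} N^k` (`mul_neg_geom_sum`).
Reindexing `Fin m ≃ S ⊕ Unit` and the Schur complement (`Matrix.det_fromBlocks₁₁`) give
`det B = det D · (B i₀ i₀ - u E v)` (`det_eq_det_mul_corner`); `det D` is a unit of `ℂ[x]`, hence a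
constant, with constant term `det 1 = 1` (`det_eq_one_of_mul_eq_one`).  So
`per_n = B i₀ i₀ - Σ_{k<K} u N^k v` with `u N^k v` homogeneous of degree `k + 2`; comparing
degree-`n` components (`eq_neg_apply_of_isHomogeneous`) leaves `per_n = -u N^{n-2} v`, and
splitting `N^{n-2} = N^{l-1} N^{n-1-l}` gives `g = u N^{l-1}` (homogeneous of degree `l`, supported
on level `l` by the weight bookkeeping) and `h = -N^{n-1-l} v`, extended by `0` at `i₀`.

Helper file for the crux (`--supports`); it closes nothing by itself.  Deliberately NOT here: the
graded normal form itself (stubs `stub_homothetyGraded`, `stub_gradedElimination`,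
`stub_partialPermDiag` of the same wave) and the strength bookkeeping of the lead's §6.
-/

-- Sub = Summit single-conjunct layout: the duplicated namespace component is mandated by the tree.
set_option linter.dupNamespace false

noncomputable section

namespace Summit.ValiantsHypothesis.ValiantsHypothesis.Theorems.FreeSubtorusOrbitDimensionBound

open MvPolynomial Finset
open Literature.Computability.AlgebraicComplexity

/-! ### Weights along powers of a graded matrix -/

/-- If every non-zero entry `N i j` drops the weight by one (`wt i = wt j + 1`), then every
non-zero entry of `N ^ k` drops it by `k`. [folklore] -/
theorem wt_eq_of_pow_apply_ne_zero {A : Type*} [Semiring A] {ι : Type*} [Fintype ι] [DecidableEq ι]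
    (N : Matrix ι ι A) (wt : ι → ℤ) (hN : ∀ i j, N i j ≠ 0 → wt i = wt j + 1) :
    ∀ (k : ℕ) (i j : ι), (N ^ k) i j ≠ 0 → wt i = wt j + k := by
  intro k
  induction k with
  | zero =>
    intro i j h
    rw [pow_zero, Matrix.one_apply] at h
    by_cases hij : i = j
    · simp [hij]
    · exact absurd (if_neg hij) h
  | succ k ih =>
    intro i j h
    rw [pow_succ, Matrix.mul_apply] at h
    obtain ⟨r, -, hr⟩ := Finset.exists_ne_zero_of_sum_ne_zero h
    have h1 := ih i r (left_ne_zero_of_mul hr)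
    have h2 := hN r j (right_ne_zero_of_mul hr)
    push_cast
    omega

/-- A graded matrix with bounded weights is nilpotent: `N ^ K = 0` as soon as `K` exceeds the
weight range. [folklore] -/
theorem pow_eq_zero_of_wt {A : Type*} [Semiring A] {ι : Type*} [Fintype ι] [DecidableEq ι]
    (N : Matrix ι ι A) (wt : ι → ℤ) (hN : ∀ i j, N i j ≠ 0 → wt i = wt j + 1) (M K : ℕ)
    (hM : ∀ i, (wt i).natAbs ≤ M) (hK : 2 * M < K) : N ^ K = 0 := by
  ext i j
  rw [Matrix.zero_apply]
  by_contra h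
  have h1 := wt_eq_of_pow_apply_ne_zero N wt hN K i j h
  have hi := hM i
  have hj := hM j
  omega

/-- The support of `u · N ^ k` sits `k + 1` levels below the source: if `u i ≠ 0 ⇒ wt i + 1 = w₀`
and `N` drops the weight by one, then `(u N^k) j ≠ 0 ⇒ wt j + (k + 1) = w₀`. [folklore] -/
theorem wt_eq_of_row_mul_pow_apply_ne_zero {A : Type*} [Semiring A] {ι κ : Type*} [Fintype ι]
    [DecidableEq ι] (U : Matrix κ ι A) (N : Matrix ι ι A) (wt : ι → ℤ) (w₀ : ℤ)
    (hU : ∀ c i, U c i ≠ 0 → wt i + 1 = w₀) (hN : ∀ i j, N i j ≠ 0 → wt i = wt j + 1)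
    (k : ℕ) (c : κ) (j : ι) (h : (U * N ^ k) c j ≠ 0) : wt j + (k + 1) = w₀ := by
  rw [Matrix.mul_apply] at h
  obtain ⟨i, -, hi⟩ := Finset.exists_ne_zero_of_sum_ne_zero h
  have h1 := hU c i (left_ne_zero_of_mul hi)
  have h2 := wt_eq_of_pow_apply_ne_zero N wt hN k i j (right_ne_zero_of_mul hi)
  omega

/-! ### Homogeneity along powers of a matrix of linear forms -/

/-- Entries of `N ^ k` are homogeneous of degree `k` when the entries of `N` are linear forms.
[folklore] -/
theorem isHomogeneous_pow_apply {R : Type*} [CommRing R] {σ ι : Type*} [Fintype ι] [DecidableEq ι]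
    (N : Matrix ι ι (MvPolynomial σ R)) (hN : ∀ i j, (N i j).IsHomogeneous 1) :
    ∀ (k : ℕ) (i j : ι), ((N ^ k) i j).IsHomogeneous k := by
  intro k
  induction k with
  | zero =>
    intro i j
    rw [pow_zero, Matrix.one_apply]
    split_ifs
    · exact isHomogeneous_one _ _
    · exact isHomogeneous_zero _ _ _
  | succ k ih =>
    intro i j
    rw [pow_succ, Matrix.mul_apply]
    exact IsHomogeneous.sum _ _ _ fun r _ => (ih i r).mul (hN r j)

/-- Entries of `U · N ^ k` are homogeneous of degree `1 + k` for linear `U`, `N`. [folklore] -/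
theorem isHomogeneous_row_mul_pow_apply {R : Type*} [CommRing R] {σ ι κ : Type*} [Fintype ι]
    [DecidableEq ι] (U : Matrix κ ι (MvPolynomial σ R)) (N : Matrix ι ι (MvPolynomial σ R))
    (hU : ∀ c i, (U c i).IsHomogeneous 1) (hN : ∀ i j, (N i j).IsHomogeneous 1) (k : ℕ) (c : κ)
    (j : ι) : ((U * N ^ k) c j).IsHomogeneous (1 + k) := by
  rw [Matrix.mul_apply]
  exact IsHomogeneous.sum _ _ _ fun i _ => (hU c i).mul (isHomogeneous_pow_apply N hN k i j)

/-- Entries of `U · N ^ k · V` are homogeneous of degree `1 + k + 1` for linear `U`, `N`, `V`.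
[folklore] -/
theorem isHomogeneous_row_mul_pow_mul_col_apply {R : Type*} [CommRing R] {σ ι κ κ' : Type*}
    [Fintype ι] [DecidableEq ι] (U : Matrix κ ι (MvPolynomial σ R))
    (N : Matrix ι ι (MvPolynomial σ R)) (V : Matrix ι κ' (MvPolynomial σ R))
    (hU : ∀ c i, (U c i).IsHomogeneous 1) (hN : ∀ i j, (N i j).IsHomogeneous 1)
    (hV : ∀ i c, (V i c).IsHomogeneous 1) (k : ℕ) (c : κ) (c' : κ') :
    ((U * N ^ k * V) c c').IsHomogeneous (1 + k + 1) := by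
  rw [Matrix.mul_apply]
  exact IsHomogeneous.sum _ _ _ fun j _ =>
    (isHomogeneous_row_mul_pow_apply U N hU hN k c j).mul (hV j c')

/-- Degree bookkeeping: if `f` is homogeneous of degree `n ≥ 2`, `w` has degree `< n`, `T k` is
homogeneous of degree `k + 2` and `f = w - Σ_{k<K} T k` with `n - 2 < K`, then `f = -T (n - 2)`
(compare homogeneous components of degree `n`). [folklore] -/
theorem eq_neg_apply_of_isHomogeneous {R : Type*} [CommRing R] {σ : Type*}
    {f w : MvPolynomial σ R} {n K : ℕ} (T : ℕ → MvPolynomial σ R) (hf : f.IsHomogeneous n)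
    (hw : w.totalDegree < n) (hT : ∀ k, (T k).IsHomogeneous (1 + k + 1)) (hK : n - 2 < K)
    (hn : 2 ≤ n) (h : f = w - ∑ k ∈ Finset.range K, T k) : f = -T (n - 2) := by
  have h1 := congrArg (homogeneousComponent n) h
  rw [homogeneousComponent_eq_self hf, map_sub, map_sum, homogeneousComponent_eq_zero _ _ hw,
    zero_sub, Finset.sum_eq_single (n - 2)] at h1
  · rwa [homogeneousComponent_of_mem (hT (n - 2)), if_pos (by omega)] at h1
  · intro k _ hk
    rw [homogeneousComponent_of_mem (hT k), if_neg (by omega)]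
  · intro hk
    exact absurd (Finset.mem_range.mpr hK) hk

/-! ### The bordered determinant -/

/-- **Schur complement around one index.**  If `D` is the `S × S` block of `B` (`S = {j ≠ i₀}`),
`Ur`, `Vc` the `i₀`-row and `i₀`-column restricted to `S`, and `D E = 1`, then
`det B = det D · (B i₀ i₀ - Ur E Vc)` (reindex `ι ≃ S ⊕ Unit`, `Matrix.det_fromBlocks₁₁`). [folklore] -/
theorem det_eq_det_mul_corner {R : Type*} [CommRing R] {ι : Type*} [Fintype ι] [DecidableEq ι]
    (B : Matrix ι ι R) (i₀ : ι) (D E : Matrix {j // j ≠ i₀} {j // j ≠ i₀} R)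
    (Ur : Matrix Unit {j // j ≠ i₀} R) (Vc : Matrix {j // j ≠ i₀} Unit R)
    (hD : ∀ s t, D s t = B s t) (hU : ∀ t, Ur () t = B i₀ t) (hV : ∀ s, Vc s () = B s i₀)
    (hE : D * E = 1) :
    B.det = D.det * (B i₀ i₀ - (Ur * E * Vc) () ()) := by
  obtain ⟨e, he₁, he₂⟩ : ∃ e : {j // j ≠ i₀} ⊕ Unit ≃ ι, (∀ s, e (Sum.inl s) = s) ∧
      e (Sum.inr ()) = i₀ :=
    ⟨(Equiv.optionEquivSumPUnit {j // j ≠ i₀}).symm.trans (Equiv.optionSubtypeNe i₀),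
      fun _ => rfl, rfl⟩
  have hB : B.submatrix e e = Matrix.fromBlocks D Vc Ur (Matrix.of fun _ _ => B i₀ i₀) := by
    ext (s | ⟨⟩) (t | ⟨⟩)
    · simp [he₁, hD]
    · simp [he₁, he₂, hV]
    · simp [he₁, he₂, hU]
    · simp [he₂]
  letI : Invertible D := invertibleOfRightInverse _ _ hE
  rw [← Matrix.det_submatrix_equiv_self e B, hB, Matrix.det_fromBlocks₁₁]
  congr 1
  rw [Matrix.det_unique]
  rfl

/-- Over a field, a matrix of polynomials with a right inverse and constant part `1` has
determinant `1`: `det D` is a unit of `k[x]`, hence a constant, and its constant term is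
`det D(0) = det 1 = 1`. [folklore] -/
theorem det_eq_one_of_mul_eq_one {k : Type*} [Field k] {σ ι : Type*} [Fintype ι] [DecidableEq ι]
    (D E : Matrix ι ι (MvPolynomial σ k)) (h : D * E = 1) (h0 : constPart D = 1) : D.det = 1 := by
  have hu : IsUnit D.det :=
    IsUnit.of_mul_eq_one E.det (by rw [← Matrix.det_mul, h, Matrix.det_one])
  obtain ⟨r, -, hr⟩ := MvPolynomial.isUnit_iff_eq_C_of_isReduced.mp hu
  have hc : constantCoeff D.det = 1 := by rw [← det_constPart, h0, Matrix.det_one]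
  rw [hr, constantCoeff_C] at hc
  rw [hr, hc, C_1]

/-- Dropping a vanishing term: `Σ_j F j = Σ_{j ≠ i₀} F j` when `F i₀ = 0`. [folklore] -/
theorem sum_eq_sum_subtype_of_eq_zero {M : Type*} [AddCommMonoid M] {ι : Type*} [Fintype ι]
    [DecidableEq ι] (F : ι → M) (i₀ : ι) (h0 : F i₀ = 0) :
    ∑ j, F j = ∑ s : {j // j ≠ i₀}, F s := by
  rw [← Finset.sum_erase Finset.univ h0]
  exact Finset.sum_subtype _ (by simp) F

/-! ### The layer cut -/

/-- **Stub `stub_layerDecomposition`** (GGIL22 Thm. 12 in pencil form).  For an affine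
determinantal representation `B` of `per_n` (`n ≥ 2`) in graded normal form — potentials `a, b`
with constants only where `a i + b j = 0`, variables only where `a i + b j = 1`, constant part
`diag(1, …, 1)` with a `0` at `i₀` — and every `1 ≤ l ≤ n - 1`: `per_n = Σ_j g_j h_j` with `g_j`
homogeneous of degree `l` and `g_j ≠ 0` only at level `l` (`a j + l = a i₀`).  Around `i₀`,
`B = [[w, u], [v, 1 - N]]` with `N` nilpotent by the grading, `det B = w - u (Σ_k N^k) v`, whose
degree-`n` component is `per_n = -u N^{n-2} v`; cut after `l - 1` further factors:
`g = u N^{l-1}`, `h = -N^{n-1-l} v`. [cite: GesmundoGhosalIkenmeyerLysikov2022, Thm. 12] -/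
theorem stub_layerDecomposition :
    ∀ (n m : ℕ), 2 ≤ n →
      ∀ (B : Matrix (Fin m) (Fin m) (MvPolynomial (Fin n × Fin n) ℂ)) (a b : Fin m → ℤ) (i₀ : Fin m),
      Literature.Computability.AlgebraicComplexity.IsAffineDetRepr
        (Literature.Computability.AlgebraicComplexity.perPoly (Fin n) ℂ) B →
      (∀ i j, Literature.Computability.AlgebraicComplexity.constPart B i j ≠ 0 → a i + b j = 0) →
      (∀ i j (v : Fin n × Fin n),
        Literature.Computability.AlgebraicComplexity.LRPencil.coeffMat B v i j ≠ 0 → a i + b j = 1) →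
      (∀ i j, Literature.Computability.AlgebraicComplexity.constPart B i j =
        if i = j ∧ i ≠ i₀ then 1 else 0) →
      ∀ l : ℕ, 1 ≤ l → l + 1 ≤ n →
        ∃ g h : Fin m → MvPolynomial (Fin n × Fin n) ℂ,
          (∀ j, (g j).IsHomogeneous l) ∧ (∀ j, g j ≠ 0 → a j + (l : ℤ) = a i₀) ∧
          Literature.Computability.AlgebraicComplexity.perPoly (Fin n) ℂ = ∑ j, g j * h j := by
  intro n m hn B a b i₀ hB hconst hvar hnf l hl hln
  obtain ⟨hdeg, hdet⟩ := hB
  -- the linear part `L` of `B` and the constant coefficients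
  obtain ⟨L, hL⟩ : ∃ L : Fin m → Fin m → MvPolynomial (Fin n × Fin n) ℂ,
      ∀ i j, L i j = ∑ v, C (coeff (Finsupp.single v 1) (B i j)) * X v := ⟨_, fun _ _ => rfl⟩
  have h0 : ∀ i j, coeff 0 (B i j) = if i = j ∧ i ≠ i₀ then (1 : ℂ) else 0 := fun i j => by
    rw [← hnf i j, constPart_apply, constantCoeff_eq]
  have hBL : ∀ i j, B i j = C (if i = j ∧ i ≠ i₀ then (1 : ℂ) else 0) + L i j := fun i j => by
    rw [← h0, hL]; exact LRPencil.eq_affine_of_totalDegree_le_one _ (hdeg i j)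
  have hLhom : ∀ i j, (L i j).IsHomogeneous 1 := fun i j => by
    rw [hL]; exact IsHomogeneous.sum _ _ _ fun v _ => isHomogeneous_C_mul_X _ _
  have hLwt : ∀ i j, L i j ≠ 0 → a i + b j = 1 := by
    intro i j h
    by_contra hne
    refine h ?_
    rw [hL]
    refine Finset.sum_eq_zero fun v _ => ?_
    have hc : coeff (Finsupp.single v 1) (B i j) = 0 := by
      by_contra hv
      exact hne (hvar i j v hv)
    rw [hc, C_0, zero_mul]
  have hb : ∀ j, j ≠ i₀ → b j = -a j := fun j hj => by
    have := hconst j j (by rw [hnf, if_pos ⟨rfl, hj⟩]; exact one_ne_zero)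
    omega
  have hBi₀ : ∀ j, B i₀ j = L i₀ j := fun j => by rw [hBL]; simp
  have hBj₀ : ∀ i, B i i₀ = L i i₀ := fun i => by rw [hBL]; simp
  -- the blocks around `i₀`
  obtain ⟨N, hN⟩ : ∃ N : Matrix {j // j ≠ i₀} {j // j ≠ i₀} (MvPolynomial (Fin n × Fin n) ℂ),
      ∀ s t, N s t = -L s t := ⟨Matrix.of fun s t => -L s t, fun _ _ => rfl⟩
  obtain ⟨Ur, hUr⟩ : ∃ Ur : Matrix Unit {j // j ≠ i₀} (MvPolynomial (Fin n × Fin n) ℂ),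
      ∀ c t, Ur c t = L i₀ t := ⟨Matrix.of fun _ t => L i₀ t, fun _ _ => rfl⟩
  obtain ⟨Vc, hVc⟩ : ∃ Vc : Matrix {j // j ≠ i₀} Unit (MvPolynomial (Fin n × Fin n) ℂ),
      ∀ s c, Vc s c = L s i₀ := ⟨Matrix.of fun s _ => L s i₀, fun _ _ => rfl⟩
  have hNwt : ∀ s t : {j // j ≠ i₀}, N s t ≠ 0 → a s = a t + 1 := fun s t h => by
    rw [hN] at h
    have h1 := hLwt s t (neg_ne_zero.mp h)
    have h2 := hb t t.2
    omega
  have hNhom : ∀ s t, (N s t).IsHomogeneous 1 := fun s t => by rw [hN]; exact (hLhom s t).neg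
  have hUwt : ∀ c t, Ur c t ≠ 0 → a t + 1 = a i₀ := fun c t h => by
    rw [hUr] at h
    have h1 := hLwt i₀ t h
    have h2 := hb t t.2
    omega
  have hUhom : ∀ c t, (Ur c t).IsHomogeneous 1 := fun c t => by rw [hUr]; exact hLhom i₀ t
  have hVhom : ∀ s c, (Vc s c).IsHomogeneous 1 := fun s c => by rw [hVc]; exact hLhom s i₀
  -- `N` is nilpotent, `D = 1 - N` has the inverse `E = Σ_{k<K} N^k` and determinant `1`
  obtain ⟨K, hK⟩ : ∃ K : ℕ, K = 2 * ∑ i, (a i).natAbs + n := ⟨_, rfl⟩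
  have hNK : N ^ K = 0 :=
    pow_eq_zero_of_wt N (fun s => a s) hNwt (∑ i, (a i).natAbs) K
      (fun s => Finset.single_le_sum (f := fun i => (a i).natAbs) (fun _ _ => Nat.zero_le _)
        (Finset.mem_univ (s : Fin m))) (by omega)
  have hDE : (1 - N) * (∑ k ∈ Finset.range K, N ^ k) = 1 := by
    rw [mul_neg_geom_sum, hNK, sub_zero]
  have hone : ∀ s t : {j // j ≠ i₀},
      (if (s : Fin m) = t ∧ (s : Fin m) ≠ i₀ then (1 : ℂ) else 0) = if s = t then 1 else 0 := by
    intro s t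
    by_cases hst : s = t
    · subst hst; simp [s.2]
    · have : (s : Fin m) ≠ t := fun h => hst (Subtype.ext h)
      simp [hst, this]
  have hD : ∀ s t, (1 - N) s t = B s t := by
    intro s t
    rw [Matrix.sub_apply, Matrix.one_apply, hN, sub_neg_eq_add, hBL, hone]
    split_ifs <;> simp
  have hdet1 : (1 - N).det = 1 := by
    refine det_eq_one_of_mul_eq_one _ _ hDE ?_
    ext s t
    rw [constPart_apply, hD, ← constPart_apply, hnf, Matrix.one_apply, hone]
  -- the Schur complement and its degree-`n` component
  have hper : perPoly (Fin n) ℂ = B i₀ i₀ - ∑ k ∈ Finset.range K, (Ur * N ^ k * Vc) () () := by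
    rw [← hdet, det_eq_det_mul_corner B i₀ (1 - N) _ Ur Vc hD (fun t => by rw [hUr, hBi₀])
      (fun s => by rw [hVc, hBj₀]) hDE, hdet1, one_mul, Matrix.mul_sum, Matrix.sum_mul,
      Matrix.sum_apply]
  have hper₂ : perPoly (Fin n) ℂ = -(Ur * N ^ (n - 2) * Vc) () () :=
    eq_neg_apply_of_isHomogeneous (fun k => (Ur * N ^ k * Vc) () ())
      (by simpa using (perPoly_isHomogeneous : (perPoly (Fin n) ℂ).IsHomogeneous _))
      (lt_of_le_of_lt (hdeg i₀ i₀) hn)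
      (fun k => isHomogeneous_row_mul_pow_mul_col_apply Ur N Vc hUhom hNhom hVhom k () ())
      (by omega) hn hper
  -- the cut after `l - 1` further factors
  have hcut : (Ur * N ^ (n - 2) * Vc) () () =
      ∑ s, (Ur * N ^ (l - 1)) () s * (N ^ (n - 1 - l) * Vc) s () := by
    rw [show n - 2 = (l - 1) + (n - 1 - l) by omega, pow_add, ← Matrix.mul_assoc,
      Matrix.mul_assoc (Ur * N ^ (l - 1)), Matrix.mul_apply]
  refine ⟨fun j => if hj : j = i₀ then 0 else (Ur * N ^ (l - 1)) () ⟨j, hj⟩,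
    fun j => if hj : j = i₀ then 0 else -(N ^ (n - 1 - l) * Vc) ⟨j, hj⟩ (), ?_, ?_, ?_⟩
  · intro j
    dsimp only
    by_cases hj : j = i₀
    · rw [dif_pos hj]; exact isHomogeneous_zero _ _ _
    · rw [dif_neg hj]
      have := isHomogeneous_row_mul_pow_apply Ur N hUhom hNhom (l - 1) () ⟨j, hj⟩
      rwa [show 1 + (l - 1) = l by omega] at this
  · intro j hj0
    dsimp only at hj0
    by_cases hj : j = i₀
    · rw [dif_pos hj] at hj0; exact absurd rfl hj0
    · rw [dif_neg hj] at hj0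
      have := wt_eq_of_row_mul_pow_apply_ne_zero Ur N (fun s => a s) (a i₀) hUwt hNwt (l - 1) ()
        ⟨j, hj⟩ hj0
      simp only at this
      omega
  · rw [hper₂, hcut, sum_eq_sum_subtype_of_eq_zero _ i₀ (by simp), ← Finset.sum_neg_distrib]
    refine Finset.sum_congr rfl fun s _ => ?_
    dsimp only
    rw [dif_neg s.2, dif_neg s.2, mul_neg]

end Summit.ValiantsHypothesis.ValiantsHypothesis.Theorems.FreeSubtorusOrbitDimensionBound

end
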